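import Literature.NumberTheory.Automorphic.Liu2021.AppendixC.AlbaneseFiniteQuotientTraceHolds
import Literature.NumberTheory.Automorphic.Liu2021.AppendixC.AlbaneseMapEpi
import Literature.NumberTheory.Automorphic.Liu2021.AppendixC.NablaSmooth
import Literature.AlgebraicGeometry.Motives.AlgPointsMapSurjectiveAlgClosed
import Mathlib.AlgebraicGeometry.Morphisms.UniversallyOpen
import HarnessLib

/-!
# Lang, *Abelian Varieties* VIII §6 Thm. 13 in full: `Alb_Y` is isogenous to the `Δ`-coinvariants of `Alb_X` —
# surjectivity of `∇p`, `Alb_p` is an epimorphism, and the second trace identity `t ∘ Alb_p… = |Δ|`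

[Liu2021] = Yifeng Liu, *Fourier–Jacobi cycles and arithmetic relative trace formula*, Camb. J. Math. **9** (2021)
= arXiv:2102.11518 (`l. NNNN` = lines of `FJcycle.tex`), §2.1 Def. 2.1 (1) («`∇X`, the smallest open and closed subscheme of
`X × X` containing `ΔX`», with `∇u` the restriction of `u × u`, l. 1171–1176), Def. 2.3 (Albanese datum, l. 1202–1208);
[Lang1983AbelianVarieties] Ch. VIII §6 Thm. 13 (pp. 224–227): for `f : U → V` generically surjective of finite degree `m`, the
homomorphism `h_* : A(V) → A(U)` satisfies `h_* f_* = Σ g_*`-type and «`f_* h_* = m·δ_{A(V)}`», so that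
`0 → A_0 → A(U) → A(V) → 0` is exact up to isogeny; [MumfordAV1970] §7 Thm. p. 66 (quotients by finite groups).
PROOF FILE (theorems only; no definition, no named fact, no instance, no `sorry`).  Cell hodgecm-mathlib (D-0151), rows
VI-3 ∕ VI-4 ∕ VI-5 (generic halves); count-neutral capital in the currency of ★ `AlbaneseFiniteQuotientTraceHolds`.

The tree has the FIRST trace identity `Alb_p ≫ t = Σ_{g ∈ Δ} Alb_{act g}` (`t` = Lang's `h_*`) for a finite quotient
`p : X ⟶ Y` of a smooth projective `X` in characteristic zero (★ `Albanese.exists_trace_of_isSepQuotient`,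
★ `albaneseTraceOfFiniteQuotient_holds`).  This file adds the SECOND identity `t ≫ Alb_p = |Δ| • 𝟙`, whose content is that
`Alb_p` is an EPIMORPHISM (Lang: `f_* h_* = m·δ` because `f` is onto), through a `∇`-lemma of independent use:

* `Nabla.range_incl_subset_image_of_surjective`, `Nabla.surjective_map_left` — **`∇p : ∇X → ∇Y` is SURJECTIVE for every
  `p : X ⟶ Y` which is surjective, universally closed and universally open** (e.g. finite flat surjective, or proper flat
  surjective of finite presentation), for ANY carriers `∇X`, `∇Y` over ANY field: the image of the open and closed `∇X ⊆ X × X`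
  under the open and closed map `p × p` is open and closed and contains `ΔY = (p × p)(ΔX)`, so it contains `∇Y` by the
  MINIMALITY of `∇Y` (Def. 2.1 (1)).  (No geometric components, no base change: compare the complex-pieces lifting route of
  ★ `Liu2021/NablaMapSurjectiveOfPieces`.)
* `Albanese.epi_map_of_surjective` — hence **`Alb_p : Alb_X ⟶ Alb_Y` is an epimorphism of abelian varieties** for such `p`
  (with `∇Y` reduced and the carriers locally of finite type — automatic for smooth `X`, `Y`:
  `Albanese.epi_map_of_surjective_of_smooth`): `∇p` is then surjective on `k̄`-points
  (★ `AlgPoints.map_surjective_of_surjective_of_isAlgClosed`) and ★ `Albanese.epi_map_of_nablaMap_surjective_algPoints` applies.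
  `Albanese.epi_map_of_isSepQuotient`: in particular for a quotient `p` of a smooth projective `X` by a finite group for
  separated test objects (★ `surjective_left_∕isFinite_left_∕flat_left_of_isSepQuotient`).
* `Albanese.trace_comp_map_eq_card_smul` — **Lang's `f_* h_* = m·δ`**: if `Alb_p ≫ t = Σ_g Alb_{act g}` with `p` invariant
  under the `act g` and `Alb_p` an epimorphism, then `t ≫ Alb_p = |Δ| • 𝟙_{Alb_Y}` (cancel `Alb_p` in
  `Alb_p ≫ t ≫ Alb_p = Σ_g Alb_{act g ≫ p} = |Δ| • Alb_p`).
* `Albanese.exists_trace_comp_eq_card_smul_of_isSepQuotient` — **VIII §6 Thm. 13 for a finite quotient, both identities**: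
  for `k` of characteristic zero, `Δ` finite acting on the smooth projective `X` with quotient `p : X ⟶ Y` (`Y` smooth
  projective, separated test objects) and Albanese data `aX`, `aY`, there is `t : Alb_Y ⟶ Alb_X` with
  `Alb_p ≫ t = Σ_g Alb_{act g}` AND `t ≫ Alb_p = |Δ| • 𝟙` — `Alb_p` and `t` are mutually inverse isogenies between `Alb_Y` and
  `Alb_X` modulo the `Δ`-action, up to `|Δ|`.

HC_CM is proved only modulo the 7 printed citations until rung 0 closes; nothing here discharges a COR-CM binder.  Ours
(formalisation glue); axioms `propext`, `Classical.choice`, `Quot.sound`.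

## References
* [Lang1983AbelianVarieties] S. Lang, *Abelian Varieties* (Springer 1983 reprint), Ch. VIII §6 Thm. 13 and its proof
  (pp. 224–227).
* [Liu2021] Y. Liu, arXiv:2102.11518 = Camb. J. Math. 9 (2021), §2.1 Def. 2.1 (1) (l. 1171–1176), Def. 2.3 (l. 1202–1208).
* [MumfordAV1970] D. Mumford, *Abelian Varieties* (1970), §7 Thm. p. 66.
-/

noncomputable section

open CategoryTheory CategoryTheory.Limits AlgebraicGeometry MonoidalCategory CartesianMonoidalCategory
open Literature.AlgebraicGeometry.Motives

universe u v

namespace Literature.NumberTheory.Automorphic.Liu2021.AppendixC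

open scoped MonObj

/-! ## §1 `∇p` is surjective for `p` surjective, universally closed and universally open -/

section NablaSurjective

variable {k : Type u} [Field k] {X Y : SchemeOver k}

/-- A morphism property stable under base change and composition passes from `p.left` to `(p ⊗ p).left = p ×_k p`
(Mathlib `MorphismProperty.pullbackMap` on `Over.tensorHom_left`). [folklore] -/
private theorem tensorHom_left_mem (P : MorphismProperty Scheme.{u}) [P.IsStableUnderBaseChange]
    [P.IsStableUnderComposition] (p : X ⟶ Y) (hp : P p.left) : P (p ⊗ₘ p).left := by
  rw [Over.tensorHom_left]
  exact MorphismProperty.pullbackMap hp hp (Over.w p).symm (Over.w p).symm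

/-- `ΔX ≫ (p × p) = p ≫ ΔY`. [folklore] -/
private theorem diag_comp_tensorHom (p : X ⟶ Y) :
    lift (𝟙 X) (𝟙 X) ≫ (p ⊗ₘ p) = p ≫ lift (𝟙 Y) (𝟙 Y) := by
  rw [lift_map, comp_lift, Category.id_comp, Category.comp_id]

/-- **`∇Y ⊆ (p × p)(∇X)`** for `p : X ⟶ Y` surjective, universally closed and universally open and ANY carriers `∇X`, `∇Y`
(Def. 2.1 (1)): the image of the open and closed `∇X ⊆ X × X` under the open and closed map `p × p` is an open and closed
subset of `Y × Y` containing the diagonal `ΔY = (p × p)(ΔX)` (`p` onto), hence — as the open subscheme it carries is an open and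
closed subscheme through which `ΔY` factors — it contains the smallest one, `∇Y` (`Nabla.minimal`).  Ours.
[cite: Liu2021, §2.1 Def. 2.1 (1) (l. 1171–1176)] -/
theorem Nabla.range_incl_subset_image_of_surjective (N : Nabla X) (N' : Nabla Y) (p : X ⟶ Y)
    [Surjective p.left] [UniversallyClosed p.left] [UniversallyOpen p.left] :
    Set.range ⇑N'.incl.left ⊆ ⇑(p ⊗ₘ p).left '' Set.range ⇑N.incl.left := by
  haveI := N.isOpenImmersion_incl
  haveI := N.isClosedImmersion_incl
  haveI : UniversallyClosed (p ⊗ₘ p).left := tensorHom_left_mem _ p inferInstance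
  haveI : UniversallyOpen (p ⊗ₘ p).left := tensorHom_left_mem _ p inferInstance
  set q := (p ⊗ₘ p).left with hq
  set W₀ : Set ↥(Y ⊗ Y).left := ⇑q '' Set.range ⇑N.incl.left with hW₀
  -- `W₀` is open and closed
  have hW₀ : IsClopen W₀ :=
    ⟨q.isClosedMap _ N.incl.left.isClosedEmbedding.isClosed_range,
      q.isOpenMap _ (IsOpenImmersion.isOpen_range N.incl.left)⟩
  -- `ΔY ⊆ W₀`
  have hΔ : Set.range ⇑(lift (𝟙 Y) (𝟙 Y)).left ⊆ W₀ := by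
    rintro _ ⟨y, rfl⟩
    obtain ⟨x, rfl⟩ := p.left.surjective y
    refine ⟨(lift (𝟙 X) (𝟙 X)).left x, ⟨N.diag.left x, ?_⟩, ?_⟩
    · rw [← Scheme.Hom.comp_apply, ← Over.comp_left, N.diag_incl]
    · rw [hq, ← Scheme.Hom.comp_apply, ← Over.comp_left, diag_comp_tensorHom, Over.comp_left, Scheme.Hom.comp_apply]
  -- the open subscheme of `Y × Y` on `W₀`, an open and closed subscheme through which `ΔY` factors
  let U : (Y ⊗ Y).left.Opens := ⟨W₀, hW₀.2⟩
  have hrange : Set.range ⇑U.ι = W₀ := Scheme.Opens.range_ι U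
  haveI hUc : IsClosedImmersion U.ι :=
    IsClosedImmersion.of_isPreimmersion _ (by simpa only [hrange] using hW₀.1)
  have hΔ' : Set.range ⇑(lift (𝟙 Y) (𝟙 Y)).left ⊆ Set.range ⇑U.ι := hΔ.trans hrange.symm.subset
  obtain ⟨dY, hfac⟩ : ∃ dY : Y.left ⟶ U, dY ≫ U.ι = (lift (𝟙 Y) (𝟙 Y)).left :=
    ⟨IsOpenImmersion.lift U.ι (lift (𝟙 Y) (𝟙 Y)).left hΔ', IsOpenImmersion.lift_fac _ _ _⟩
  let W : SchemeOver k := Over.mk (U.ι ≫ (Y ⊗ Y).hom)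
  let j : W ⟶ Y ⊗ Y := Over.homMk U.ι rfl
  have hδ : ∃ δ : Y ⟶ W, δ ≫ j = lift (𝟙 Y) (𝟙 Y) :=
    ⟨Over.homMk dY (by
        change dY ≫ U.ι ≫ (Y ⊗ Y).hom = Y.hom
        rw [← Category.assoc, hfac]
        exact Over.w (lift (𝟙 Y) (𝟙 Y))), Over.OverMorphism.ext hfac⟩
  -- minimality of `∇Y`
  obtain ⟨f, hf⟩ := N'.minimal W j (inferInstanceAs (IsOpenImmersion U.ι)) hUc hδ
  rintro _ ⟨n', rfl⟩
  have h1 : N'.incl.left n' = j.left (f.left n') := by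
    rw [← Scheme.Hom.comp_apply, ← Over.comp_left, hf]
  have hjr : Set.range ⇑j.left = W₀ := hrange
  rw [h1, ← hjr]
  exact ⟨_, rfl⟩

/-- **`∇p : ∇X → ∇Y` is surjective** for every `p : X ⟶ Y` of `k`-schemes which is surjective, universally closed and
universally open (e.g. finite, flat and surjective), and ANY carriers `∇X`, `∇Y` (Def. 2.1 (1), `∇p` the restriction of
`p × p`, `Nabla.map`): every point of `∇Y` is `(p × p)(n)` for a point `n` of `∇X`
(`Nabla.range_incl_subset_image_of_surjective`), and `∇Y ↪ Y × Y` is injective.  Ours.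
[cite: Liu2021, §2.1 Def. 2.1 (1) (l. 1171–1176)] -/
theorem Nabla.surjective_map_left (N : Nabla X) (N' : Nabla Y) (p : X ⟶ Y)
    [Surjective p.left] [UniversallyClosed p.left] [UniversallyOpen p.left] :
    Surjective (N.map N' p).left := by
  haveI := N'.isOpenImmersion_incl
  refine ⟨fun n' => ?_⟩
  obtain ⟨_, ⟨n, rfl⟩, hn⟩ := N.range_incl_subset_image_of_surjective N' p ⟨n', rfl⟩
  refine ⟨n, N'.incl.left.isOpenEmbedding.injective ?_⟩
  rw [← hn, ← Scheme.Hom.comp_apply, ← Scheme.Hom.comp_apply, ← Over.comp_left, ← Over.comp_left, N.map_incl]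

end NablaSurjective

/-! ## §2 `Alb_p` is an epimorphism -/

section Epi

variable {k : Type u} [Field k] {X Y : SchemeOver k}

/-- **`Alb_p` is an epimorphism of abelian varieties for `p : X ⟶ Y` surjective, universally closed and universally open**
(ANY field `k`, ANY Albanese data of Def. 2.3; the carriers locally of finite type over `k` and `∇Y` reduced): `∇p` is
surjective (`Nabla.surjective_map_left`), hence surjective on `k̄`-points, and a homomorphism out of `Alb_Y` is determined
by its composite with `α_Y` on `k̄`-points.  Ours. [cite: Lang1983AbelianVarieties, Ch. VIII §6 Thm. 13 (proof, pp. 224–227)]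
[cite: Liu2021, §2.1 Def. 2.1 (1) (l. 1171–1176), Def. 2.3 (l. 1202–1208)] -/
theorem Albanese.epi_map_of_surjective (aX : Albanese X) (aY : Albanese Y) (p : X ⟶ Y)
    [Surjective p.left] [UniversallyClosed p.left] [UniversallyOpen p.left]
    [LocallyOfFiniteType aX.nabla.N.hom] [LocallyOfFiniteType aY.nabla.N.hom] [IsReduced aY.nabla.N.left] :
    Epi (aX.map aY p) := by
  haveI : Surjective (aX.nabla.map aY.nabla p).left := aX.nabla.surjective_map_left aY.nabla p
  haveI : LocallyOfFiniteType ((aX.nabla.map aY.nabla p).left ≫ aY.nabla.N.hom) := by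
    rw [Over.w (aX.nabla.map aY.nabla p)]
    infer_instance
  haveI : LocallyOfFiniteType (aX.nabla.map aY.nabla p).left :=
    locallyOfFiniteType_of_comp (aX.nabla.map aY.nabla p).left aY.nabla.N.hom
  refine Albanese.epi_map_of_nablaMap_surjective_algPoints (AlgebraicClosure k) aX aY p fun P => ?_
  obtain ⟨Q, hQ⟩ :=
    AlgPoints.map_surjective_of_surjective_of_isAlgClosed (L := AlgebraicClosure k) (aX.nabla.map aY.nabla p) P
  exact ⟨Q, hQ⟩

set_option backward.isDefEq.respectTransparency false in
/-- `X × X → Spec k` is smooth for `X → Spec k` smooth of relative dimension `d` (universe-polymorphic copy of the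
universe-`0` lemma of ★ `AppendixC/NablaSmooth`). [folklore] -/
private theorem smooth_tensorObj_hom' {d : ℕ} [SmoothOfRelativeDimension d X.hom] : Smooth (X ⊗ X).hom := by
  haveI := smoothOfRelativeDimension_isStableUnderBaseChange (n := d)
  haveI : SmoothOfRelativeDimension d (pullback.fst X.hom X.hom) :=
    MorphismProperty.pullback_fst _ _ ‹_›
  haveI : SmoothOfRelativeDimension (d + d) (X ⊗ X).hom := by
    rw [Over.tensorObj_hom]; infer_instance
  exact SmoothOfRelativeDimension.smooth (d + d) _

/-- `∇X` is reduced for `X` smooth over `k` (universe-polymorphic copy of ★ `Nabla.isReduced_left`).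
[cite: StacksProject, Tag 056T (Varieties, Lemma 33.25.4)] -/
private theorem Nabla.isReduced_left' {d : ℕ} [SmoothOfRelativeDimension d X.hom] (N : Nabla X) :
    IsReduced N.N.left := by
  haveI := N.isOpenImmersion_incl
  haveI : Smooth (X ⊗ X).hom := smooth_tensorObj_hom' (d := d)
  haveI : IsReduced (X ⊗ X).left := isReduced_of_smooth_over_field (X ⊗ X).hom
  exact isReduced_of_isOpenImmersion N.incl.left

/-- `∇X → Spec k` is locally of finite type for `X` smooth over `k` (universe-polymorphic copy of
★ `Nabla.locallyOfFiniteType_hom`). [cite: Liu2021, Def. 2.1 (1), l. 1171–1174] -/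
private theorem Nabla.locallyOfFiniteType_hom' {d : ℕ} [SmoothOfRelativeDimension d X.hom] (N : Nabla X) :
    LocallyOfFiniteType N.N.hom := by
  haveI := N.isOpenImmersion_incl
  haveI : Smooth (X ⊗ X).hom := smooth_tensorObj_hom' (d := d)
  rw [← Over.w N.incl]
  infer_instance

/-- **`Alb_p` is an epimorphism for `p : X ⟶ Y` surjective, universally closed and universally open between SMOOTH
`k`-schemes** (the carriers `∇X ⊆ X × X`, `∇Y ⊆ Y × Y` are then reduced and locally of finite type,
★ `Nabla.isReduced_left` ∕ `Nabla.locallyOfFiniteType_hom`).  Ours. [cite: Lang1983AbelianVarieties, Ch. VIII §6 Thm. 13 (proof, pp. 224–227)] -/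
theorem Albanese.epi_map_of_surjective_of_smooth {dX dY : ℕ} [SmoothOfRelativeDimension dX X.hom]
    [SmoothOfRelativeDimension dY Y.hom] (aX : Albanese X) (aY : Albanese Y) (p : X ⟶ Y)
    [Surjective p.left] [UniversallyClosed p.left] [UniversallyOpen p.left] : Epi (aX.map aY p) := by
  haveI := aX.nabla.locallyOfFiniteType_hom' (d := dX)
  haveI := aY.nabla.locallyOfFiniteType_hom' (d := dY)
  haveI := aY.nabla.isReduced_left' (d := dY)
  exact aX.epi_map_of_surjective aY p

/-- Over a locally Noetherian base, locally of finite type implies locally of finite presentation. [folklore] -/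
private theorem locallyOfFinitePresentation_of_isLocallyNoetherian' {S T : Scheme.{u}} (g : S ⟶ T)
    [IsLocallyNoetherian T] [LocallyOfFiniteType g] : LocallyOfFinitePresentation g := by
  rw [HasRingHomProperty.iff_appLE (P := @LocallyOfFinitePresentation)]
  intro U V e
  haveI := IsLocallyNoetherian.component_noetherian (X := T) U
  exact RingHom.FinitePresentation.of_finiteType.mp
    (HasRingHomProperty.appLE @LocallyOfFiniteType g inferInstance U V e)

/-- **`Alb_p` is an epimorphism for a finite quotient `p : X ⟶ Y = X/Δ`** of a smooth projective `X` by a finite group of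
`k`-automorphisms, `Y` smooth projective, quotient for separated test objects (`Motives.IsSepQuotient`): such a `p` is surjective,
finite (hence universally closed) and flat of finite presentation (hence universally open) — ★ `surjective_left_of_isSepQuotient`,
★ `isFinite_left_of_isSepQuotient`, ★ `flat_left_of_isSepQuotient`.  Ours. [cite: MumfordAV1970, §7 Thm. p. 66]
[cite: Lang1983AbelianVarieties, Ch. VIII §6 Thm. 13 (proof, pp. 224–227)] -/
theorem Albanese.epi_map_of_isSepQuotient {dX dY : ℕ} [SmoothOfRelativeDimension dX X.hom]
    [SmoothOfRelativeDimension dY Y.hom] (hX : IsProjectiveOver X) (hY : IsProjectiveOver Y)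
    {Δ : Type v} [Group Δ] [Finite Δ] (act : Δ →* Aut X) (p : X ⟶ Y) (hp : IsSepQuotient (fun g => act g) p)
    (aX : Albanese X) (aY : Albanese Y) : Epi (aX.map aY p) := by
  haveI : IsProper X.hom := hX.isProper
  haveI : IsProper Y.hom := hY.isProper
  haveI : Surjective p.left := surjective_left_of_isSepQuotient hX inferInstance act p hp
  haveI : IsFinite p.left := isFinite_left_of_isSepQuotient hX inferInstance act p hp
  haveI : Flat p.left := flat_left_of_isSepQuotient (dX := dX) (dY := dY) hX hY act p hp
  haveI : IsLocallyNoetherian Y.left := LocallyOfFiniteType.isLocallyNoetherian Y.hom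
  haveI : LocallyOfFinitePresentation p.left := locallyOfFinitePresentation_of_isLocallyNoetherian' p.left
  haveI : UniversallyOpen p.left := UniversallyOpen.of_flat p.left
  exact aX.epi_map_of_surjective_of_smooth (dX := dX) (dY := dY) aY p

end Epi

/-! ## §3 Lang's second identity `f_* h_* = m·δ` and VIII §6 Thm. 13 for finite quotients -/

section Trace

variable {k : Type u} [Field k] {X Y : SchemeOver k}

/-- **Lang's `f_* h_* = m·δ_{A(V)}`.**  Let `p : X ⟶ Y` be invariant under the automorphisms `act g` (`g` in a finite type
`Δ`), `aX`, `aY` Albanese data and `t : Alb_Y ⟶ Alb_X` with the trace identity `Alb_p ≫ t = Σ_g Alb_{act g}` (Lang's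
`h_*`).  If `Alb_p` is an epimorphism then `t ≫ Alb_p = |Δ| • 𝟙_{Alb_Y}`: indeed
`Alb_p ≫ (t ≫ Alb_p) = Σ_g Alb_{act g} ≫ Alb_p = Σ_g Alb_{act g ≫ p} = |Δ| • Alb_p = Alb_p ≫ (|Δ| • 𝟙)`.  Ours.
[cite: Lang1983AbelianVarieties, Ch. VIII §6 Thm. 13 (proof, pp. 224–227: «f_* h_* = m·δ»)] -/
theorem Albanese.trace_comp_map_eq_card_smul (aX : Albanese X) (aY : Albanese Y) {Δ : Type v} [Fintype Δ]
    (act : Δ → Aut X) (p : X ⟶ Y) (hinv : ∀ g, (act g).hom ≫ p = p) (t : aY.Alb ⟶ aX.Alb)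
    (ht : aX.map aY p ≫ t = ∑ g, aX.map aX (act g).hom) [Epi (aX.map aY p)] :
    t ≫ aX.map aY p = (Fintype.card Δ : ℤ) • 𝟙 aY.Alb := by
  rw [← cancel_epi (aX.map aY p), ← Category.assoc, ht, Preadditive.sum_comp, Preadditive.comp_zsmul,
    Category.comp_id]
  simp_rw [← Albanese.map_comp, hinv]
  rw [Finset.sum_const, Finset.card_univ, natCast_zsmul]

/-- **Lang, *Abelian Varieties* VIII §6 Thm. 13 for a finite quotient — both identities.**  For `k` of characteristic zero,
`Δ` a finite group acting on the smooth projective `X`, `p : X ⟶ Y` a quotient for separated test objects with `Y` smooth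
projective, and Albanese data `aX`, `aY` (Def. 2.3), there is `t : Alb_Y ⟶ Alb_X` (Lang's `h_*`) with
`Alb_p ≫ t = Σ_{g ∈ Δ} Alb_{act g}` (★ `Albanese.exists_trace_of_isSepQuotient`) AND `t ≫ Alb_p = |Δ| • 𝟙_{Alb_Y}`
(`Albanese.trace_comp_map_eq_card_smul`, `Alb_p` being an epimorphism by `Albanese.epi_map_of_isSepQuotient`): `Alb_Y` is
isogenous to `Alb_X` modulo the `Δ`-action.  Ours. [cite: Lang1983AbelianVarieties, Ch. VIII §6 Thm. 13 (pp. 224–227)]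
[cite: MumfordAV1970, §7 Thm. p. 66] -/
theorem Albanese.exists_trace_comp_eq_card_smul_of_isSepQuotient [CharZero k] {dX dY : ℕ}
    [SmoothOfRelativeDimension dX X.hom] [SmoothOfRelativeDimension dY Y.hom]
    (hX : IsProjectiveOver X) (hY : IsProjectiveOver Y) {Δ : Type v} [Group Δ] [Fintype Δ]
    (act : Δ →* Aut X) (p : X ⟶ Y) (hp : IsSepQuotient (fun g => act g) p) (aX : Albanese X) (aY : Albanese Y) :
    ∃ t : aY.Alb ⟶ aX.Alb, aX.map aY p ≫ t = ∑ g, aX.map aX (act g).hom ∧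
      t ≫ aX.map aY p = (Fintype.card Δ : ℤ) • 𝟙 aY.Alb := by
  obtain ⟨t, ht⟩ := Albanese.exists_trace_of_isSepQuotient (dX := dX) (dY := dY) hX hY act p hp aX aY
  haveI := Albanese.epi_map_of_isSepQuotient (dX := dX) (dY := dY) hX hY act p hp aX aY
  exact ⟨t, ht, aX.trace_comp_map_eq_card_smul aY (fun g => act g) p hp.1 t ht⟩

end Trace

end Literature.NumberTheory.Automorphic.Liu2021.AppendixC

end
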